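import Literature.Probability.RandomPlanarGeometry.RestrictionMeasures
import Literature.Probability.RandomPlanarGeometry.RestrictionHullsProofs
import Literature.Probability.RandomPlanarGeometry.RestrictionHullsRiemannProofs
import Literature.Probability.RandomPlanarGeometry.HalfPlaneFillProofs
import Literature.Probability.RandomPlanarGeometry.RestrictionConfigEvents
import HarnessLib

/-!
# The exponent of a restriction measure carried by simple curves ([LSW] p. 5 result 2): what is proved, what is deep

The named fact `Literature.Probability.RandomPlanarGeometry.IsRestrictionMeasure.eq_five_eighths_of_outer_simple` of
`Literature.Probability.RandomPlanarGeometry.RestrictionMeasures` vendors, after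

* G. F. Lawler, O. Schramm, W. Werner, *Conformal restriction: the chordal case*, J. Amer. Math.
  Soc. **16** (2003) 917–955, arXiv:math/0209343 (**[LSW]**, arXiv page numbers),

the first sentence of p. 5 result 2, "The only measure `P_α` that is supported on simple curves
is `P_{5/8}`", in the outer-measure reading: if `P` is a two-sided restriction measure with
exponent `α` (`IsRestrictionMeasure α P`, Prop. 3.3 (3) / Def. 3.4) and every measurable event
containing the simple-curve configurations is `P`-almost sure, then `α = 5/8`. In the paper
this sentence summarises two theories absent from the tree: `α < 5/8` is excluded by Cor. 8.6
(p. 37: no `P_α`, via the one-sided measures `P⁺_α` and SLE(8/3, ρ) of §8), and for `α > 5/8`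
the measure `P_α` is the law of an SLE_κ curve decorated with a Poisson cloud of filled
Brownian bubbles of positive intensity (Thm. 7.3, p. 29, with the uniqueness of Prop. 3.3).

NEW CONTENT OF THIS FILE.

1. PROVED — **restriction measures have positive exponent**
   (`Literature.Probability.RandomPlanarGeometry.IsRestrictionMeasure.exponent_pos`; [LSW] Prop. 3.3 (3) "There exists an `α > 0` …",
   end of its proof, p. 13: "The case `α = 0` clearly implies `K = ∅` a.s., which is not
   permitted"). In the tree's `IsRestrictionMeasure α P` the exponent is a free real parameter;
   for `α ≤ 0`, `P[K ∩ A = ∅] = Φ'_A(0)^α ≥ 1` for every `A ∈ 𝒬*`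
   (`measure_avoid_eq_one_of_nonpos`; `Φ_A`, `Φ'_A(0) ∈ (0, 1]` by the tree's proofs
   `IsStarHull.existsUnique_isRestrictionMap_holds`, `IsStarHull.exists_hasRestrictionDeriv_holds`),
   so `K` would almost surely miss every member of a countable family of `*`-hulls covering
   `ℍ` — `Literature.Probability.RandomPlanarGeometry.exists_isStarHull_ball_subset`, `Literature.Probability.RandomPlanarGeometry.exists_countable_isStarHull_cover`: every
   `z ∈ ℍ` has a `*`-hull neighbourhood, the half-plane fill ([LSW] §2 "Fillings", `hpFill`) of
   the disc `B̄(z, Im z/2)` with a stick down to a real point `p ≠ 0` (`isStarHull_hpFill` with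
   Conway VIII.2.2, `isSimplyConnected_of_isConnected_compl_holds`), plus Lindelöf — i.e.
   `K = ∅`, whereas configurations are nonempty.
2. NAMED FACT — `Literature.Probability.RandomPlanarGeometry.not_exists_isRestrictionMeasure_of_lt_five_eighths`, [LSW] **Cor. 8.6**
   (p. 37) verbatim ("For all `α < 5/8`, the two-sided restriction probability measure `P_α`
   does not exist", standing `α > 0`). NOTHING NEW TO DISCHARGE HERE: it is literally the
   "only if" half of the tree's named fact `exists_isRestrictionMeasure_iff` (p. 5 result 1),
   as `not_exists_isRestrictionMeasure_of_lt_five_eighths_of_iff` proves; it is kept as a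
   separate name only because it is the leaf the assembly uses. With 1.:
   `IsRestrictionMeasure.five_eighths_le` (`5/8 ≤ α` for every `P_α`).
3. NAMED FACT — `Literature.Probability.RandomPlanarGeometry.IsRestrictionMeasure.ae_interior_nonempty_of_gt_five_eighths`: the
   content of [LSW] **Thm. 7.3** (p. 29) that contradicts "supported on simple curves": for
   `α > 5/8`, `P_α`-almost every configuration has an interior point (the event is measurable:
   `RestrictionConfig.measurableSet_interior_nonempty`, `RestrictionConfigEvents`). See its
   docstring for exactly which printed statements and which standard properties of Brownian
   bubbles this combines. This is the genuinely deep leaf (SLE_κ, the bubble measure `μ`,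
   Poisson clouds, Thm. 7.3 itself are not in the tree).
4. PROVED — the passage from 3. to "not supported on simple curves"
   (`IsRestrictionMeasure.exists_measure_lt_one_of_gt_five_eighths`: the measurable event
   `{int K = ∅}` contains every simple curve, `RestrictionConfig.IsSimplePath.interior_eq_empty`,
   and is `P_α`-null; all in `RestrictionConfigEvents`), and the assembly
   `IsRestrictionMeasure.eq_five_eighths_of_outer_simple_of_facts` (from 2. and 3.; variant
   `_of_iff` from `exists_isRestrictionMeasure_iff` and 3.).

So `eq_five_eighths_of_outer_simple_holds` is reduced to discharging Cor. 8.6 (equivalently the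
"only if" half of `exists_isRestrictionMeasure_iff`) and the interior-point form of Thm. 7.3.

Mathlib: `TopologicalSpace.countable_cover_nhdsWithin` (Lindelöf property of second-countable
spaces), `MeasureTheory.ae_ball_iff`, `Real.one_le_rpow_of_pos_of_le_one_of_nonpos`,
`Convex.isConnected`, `convex_halfSpace_im_le`.
-/

noncomputable section

open Set Filter Topology MeasureTheory Metric
open UpperHalfPlane (upperHalfPlaneSet)
open scoped NNReal ENNReal

namespace Literature.Probability.RandomPlanarGeometry

/-! ### Every point of `ℍ` has a `*`-hull neighbourhood -/

/-- Points of the vertical stick `{p + it : 0 ≤ t ≤ h}` in coordinates. [folklore] -/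
theorem mem_image_stick_iff {p h : ℝ} {w : ℂ} :
    w ∈ (fun t : ℝ ↦ (p : ℂ) + t * Complex.I) '' Icc 0 h ↔ w.re = p ∧ 0 ≤ w.im ∧ w.im ≤ h := by
  constructor
  · rintro ⟨t, ⟨ht0, hth⟩, rfl⟩
    exact ⟨by simp, by simpa using ht0, by simpa using hth⟩
  · rintro ⟨hre, h0, hh⟩
    exact ⟨w.im, ⟨h0, hh⟩, Complex.ext (by simp [hre]) (by simp)⟩

/-- **A `*`-hull neighbourhood of a point of `ℍ`, with a prescribed side for the stick.** For
`z = x + iy`, `y > 0`, and a sign `σ = ±1` with `σx ≥ 0`, the half-plane fill of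
`S = B̄(z, y/2) ∪ [p, p + iy]`, `p = x + σy/4` (so `σp > 0`, in particular `p ≠ 0`), is a
`*`-hull containing the open disc `B(z, y/2)`: `S` is compact and attached to the lower
half-plane through the foot `p` of the stick, so `hpFill S ∈ 𝒬` (`isBoundedHull_hpFill`, Conway
VIII.2.2), and `0 ∉ hpFill S` because the ray `t ↦ t(−2σ + i)` runs from `0` to `∞` in
`ℍ ∪ {0}` without meeting `S` (`zero_notMem_hpFill_of_disjoint`). [folklore] -/
theorem exists_isStarHull_ball_subset_of_sign {z : ℂ} (hz : 0 < z.im) {σ : ℝ}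
    (hσ : σ = 1 ∨ σ = -1) (hσx : 0 ≤ σ * z.re) :
    ∃ A : Set ℂ, IsStarHull A ∧ ball z (z.im / 2) ⊆ A := by
  have hσ2 : σ * σ = 1 := by rcases hσ with rfl | rfl <;> norm_num
  have hσa : |σ| = 1 := by rcases hσ with rfl | rfl <;> norm_num
  -- the foot of the stick
  set p : ℝ := z.re + σ * (z.im / 4) with hp
  have hσp : 0 < σ * p := by
    have : σ * p = σ * z.re + z.im / 4 := by
      rw [hp, mul_add, ← mul_assoc, hσ2, one_mul]
    rw [this]
    linarith
  -- the test set: closed disc plus stick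
  set T : Set ℂ := (fun t : ℝ ↦ (p : ℂ) + t * Complex.I) '' Icc 0 z.im with hT
  set S : Set ℂ := closedBall z (z.im / 2) ∪ T with hS
  have hTc : IsCompact T := isCompact_Icc.image (by fun_prop)
  have hSclosed : IsClosed S := isClosed_closedBall.union hTc.isClosed
  have hSb : Bornology.IsBounded S := isBounded_closedBall.union hTc.isBounded
  -- the top of the stick lies in the disc, its foot on the real line
  have htop : (p : ℂ) + (z.im : ℝ) * Complex.I ∈ closedBall z (z.im / 2) := by
    rw [mem_closedBall, dist_eq_norm]
    have : (p : ℂ) + (z.im : ℝ) * Complex.I - z = ((σ * (z.im / 4) : ℝ) : ℂ) := by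
      apply Complex.ext <;> simp [hp]
    rw [this, Complex.norm_real, Real.norm_eq_abs, abs_mul, hσa, one_mul,
      abs_of_pos (by positivity)]
    linarith
  have htopT : (p : ℂ) + (z.im : ℝ) * Complex.I ∈ T := ⟨z.im, ⟨hz.le, le_rfl⟩, rfl⟩
  have hbotT : (p : ℂ) ∈ T := ⟨0, ⟨le_rfl, hz.le⟩, by simp⟩
  -- `S ∪ {Im ≤ 0}` is connected
  have hconn : IsConnected (S ∪ {w : ℂ | w.im ≤ 0}) := by
    have hB : IsConnected (closedBall z (z.im / 2)) :=
      (convex_closedBall z _).isConnected ⟨_, htop⟩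
    have hT' : IsConnected T :=
      (isConnected_Icc hz.le).image _ (by fun_prop : Continuous fun t : ℝ ↦ (p : ℂ) + t * Complex.I).continuousOn
    have hS' : IsConnected S := IsConnected.union ⟨_, htop, htopT⟩ hB hT'
    have hL : IsConnected {w : ℂ | w.im ≤ 0} :=
      (convex_halfSpace_im_le 0).isConnected ⟨0, by simp⟩
    exact IsConnected.union ⟨p, Or.inr hbotT, by simp⟩ hS' hL
  -- `0 ∉ hpFill S`: escape along the ray `t ↦ t (-2σ + i)`
  have h0 : (0 : ℂ) ∉ hpFill S := by
    set v : ℂ := ⟨-2 * σ, 1⟩ with hv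
    have hre : ∀ t : ℝ, ((t : ℂ) * v).re = -2 * σ * t := fun t ↦ by
      simp [hv]; ring
    have him : ∀ t : ℝ, ((t : ℂ) * v).im = t := fun t ↦ by simp [hv]
    refine zero_notMem_hpFill_of_disjoint hSclosed (γ := fun t : ℝ≥0 ↦ ((t : ℝ) : ℂ) * v)
      (by fun_prop) (by simp) ?_ ?_ ?_
    · intro t ht
      show 0 < ((((t : ℝ) : ℂ)) * v).im
      rw [him]
      exact_mod_cast ht
    · have hvn : 0 < ‖v‖ := by
        refine norm_pos_iff.2 fun h ↦ ?_
        have := congrArg Complex.im h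
        simp [hv] at this
      have : (fun t : ℝ≥0 ↦ ‖(((t : ℝ) : ℂ)) * v‖) = fun t : ℝ≥0 ↦ (t : ℝ) * ‖v‖ := by
        ext t
        rw [norm_mul, Complex.norm_real, Real.norm_eq_abs, NNReal.abs_eq]
      rw [this]
      exact (NNReal.tendsto_coe_atTop.2 tendsto_id).atTop_mul_const hvn
    · rw [Set.disjoint_left]
      rintro _ ⟨t, rfl⟩ hw
      rcases hw with hw | hw
      · -- a point of the ray in the disc: `t ≥ y/2` by the imaginary parts, but then the real
        -- part `-2σt` is farther than `y/2` from `x` (as `σx ≥ 0`)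
        rw [mem_closedBall, dist_eq_norm] at hw
        have h1 := (Complex.abs_im_le_norm _).trans hw
        have h2 := (Complex.abs_re_le_norm _).trans hw
        rw [Complex.sub_im, him] at h1
        rw [Complex.sub_re, hre] at h2
        rw [abs_le] at h1 h2
        have ht0 : (0 : ℝ) ≤ t := t.2
        rcases hσ with rfl | rfl
        · have hx : 0 ≤ z.re := by simpa using hσx
          linarith [h1.1, h2.1]
        · have hx : z.re ≤ 0 := by linarith
          linarith [h1.1, h2.2]
      · -- a point of the ray on the stick: `-2σt = p`, so `σp = -2t ≤ 0`
        obtain ⟨hre', -, -⟩ := mem_image_stick_iff.1 hw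
        rw [hre] at hre'
        have : σ * p = -2 * t := by
          rw [← hre']
          have ht : σ * (-2 * σ * (t : ℝ)) = -2 * (σ * σ) * t := by ring
          rw [ht, hσ2, mul_one]
        have ht0 : (0 : ℝ) ≤ t := t.2
        linarith
  refine ⟨hpFill S,
    isStarHull_hpFill isSimplyConnected_of_isConnected_compl_holds hSclosed hSb hconn h0, ?_⟩
  -- `B(z, y/2) ⊆ S ∩ ℍ ⊆ hpFill S`
  intro w hw
  refine inter_subset_hpFill S ⟨Or.inl (ball_subset_closedBall hw), ?_⟩
  show 0 < w.im
  rw [mem_ball, dist_eq_norm] at hw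
  have := (Complex.abs_im_le_norm (w - z)).trans_lt hw
  rw [Complex.sub_im, abs_lt] at this
  linarith [this.1]

/-- **Every point of `ℍ` has a `*`-hull neighbourhood**: for `z ∈ ℍ` there is `A ∈ 𝒬*` with
`B(z, Im z/2) ⊆ A` (stick to the right of `z` if `Re z ≥ 0`, to the left otherwise). In
particular `𝒬*` covers `ℍ`. [folklore] -/
theorem exists_isStarHull_ball_subset {z : ℂ} (hz : z ∈ upperHalfPlaneSet) :
    ∃ A : Set ℂ, IsStarHull A ∧ ball z (z.im / 2) ⊆ A := by
  rcases le_or_gt 0 z.re with h | h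
  · exact exists_isStarHull_ball_subset_of_sign hz (Or.inl rfl) (by simpa using h)
  · exact exists_isStarHull_ball_subset_of_sign hz (Or.inr rfl) (by linarith)

/-- **`ℍ` is covered by countably many `*`-hulls** (Lindelöf): there is a countable family of
`*`-hulls whose union contains the open upper half-plane. [folklore] -/
theorem exists_countable_isStarHull_cover :
    ∃ 𝓕 : Set (Set ℂ), 𝓕.Countable ∧ (∀ A ∈ 𝓕, IsStarHull A) ∧ upperHalfPlaneSet ⊆ ⋃₀ 𝓕 := by
  obtain ⟨t, htH, htc, hcover⟩ := TopologicalSpace.countable_cover_nhdsWithin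
    (s := upperHalfPlaneSet) (f := fun z : ℂ ↦ ball z (z.im / 2))
    fun z hz ↦ mem_nhdsWithin_of_mem_nhds (ball_mem_nhds z (half_pos hz))
  choose! A hA hballA using fun z (hz : z ∈ upperHalfPlaneSet) ↦ exists_isStarHull_ball_subset hz
  refine ⟨A '' t, htc.image A, ?_, fun w hw ↦ ?_⟩
  · rintro _ ⟨z, hz, rfl⟩
    exact hA z (htH hz)
  · obtain ⟨z, hz, hwz⟩ := mem_iUnion₂.1 (hcover hw)
    exact ⟨A z, mem_image_of_mem A hz, hballA z (htH hz) hwz⟩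

/-! ### Restriction measures have positive exponent ([LSW] Prop. 3.3, end of proof) -/

/-- **For `α ≤ 0` every `*`-hull would be avoided almost surely**: if `IsRestrictionMeasure α P`
with `α ≤ 0` then `P[K ∩ A = ∅] = Φ'_A(0)^α ≥ 1` for every `A ∈ 𝒬*`, since
`0 < Φ'_A(0) ≤ 1` ([LSW] (2.4); `Φ_A` and `Φ'_A(0)` exist by the tree's proofs
`IsStarHull.existsUnique_isRestrictionMap_holds`, `IsStarHull.exists_hasRestrictionDeriv_holds`).
[LSW] proof of Prop. 3.3: "Define the homomorphism `F` of `𝒬*` onto the multiplicative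
semigroup `(0, 1]` by `F(A) = P[K ∩ A = ∅]`."
[cite: LawlerSchrammWerner2003Restriction, proof of Prop. 3.3 (pp. 11–13) with (2.4) p. 7] -/
theorem IsRestrictionMeasure.measure_avoid_eq_one_of_nonpos {α : ℝ} {P : Measure RestrictionConfig}
    (h : IsRestrictionMeasure α P) (hα : α ≤ 0) {A : Set ℂ} (hA : IsStarHull A) :
    P (RestrictionConfig.avoid A) = 1 := by
  haveI := h.isProbabilityMeasure
  obtain ⟨Φ, hΦ, -⟩ := IsStarHull.existsUnique_isRestrictionMap_holds hA
  obtain ⟨d, hd0, hd1, hd⟩ := IsStarHull.exists_hasRestrictionDeriv_holds hA hΦ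
  refine le_antisymm prob_le_one ?_
  rw [h.2 hA hΦ hd]
  exact ENNReal.one_le_ofReal.2 (Real.one_le_rpow_of_pos_of_le_one_of_nonpos hd0 hd1 hα)

/-- **Restriction measures have positive exponent** ([LSW] Prop. 3.3 (3), p. 10: "There exists
an `α > 0` such that for all `A ∈ 𝒬*`, `P[K ∩ A = ∅] = Φ'_A(0)^α`"; end of its proof: "this
establishes 4 with `α ≥ 0`. The case `α = 0` clearly implies `K = ∅` a.s., which is not
permitted"). In the tree's `IsRestrictionMeasure α P` the exponent is a free real parameter; for
`α ≤ 0` the configuration would almost surely miss every hull of a countable family of `*`-hulls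
covering `ℍ` (`exists_countable_isStarHull_cover`), hence be empty, whereas configurations are
nonempty subsets of `ℍ`. [cite: LawlerSchrammWerner2003Restriction, Prop. 3.3 (3) (p. 10) and end of its proof (pp. 11–13)] -/
theorem IsRestrictionMeasure.exponent_pos {α : ℝ} {P : Measure RestrictionConfig}
    (h : IsRestrictionMeasure α P) : 0 < α := by
  by_contra hα'
  have hα : α ≤ 0 := not_lt.1 hα'
  haveI := h.isProbabilityMeasure
  obtain ⟨𝓕, h𝓕c, h𝓕, hcover⟩ := exists_countable_isStarHull_cover
  -- almost surely, `K` misses every hull of the family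
  have hae : ∀ᵐ K ∂P, ∀ A ∈ 𝓕, K ∈ RestrictionConfig.avoid A := by
    refine (ae_ball_iff h𝓕c).2 fun A hA ↦ mem_ae_iff.2 ?_
    exact (prob_compl_eq_zero_iff (RestrictionConfig.measurableSet_avoid (h𝓕 A hA))).2
      (h.measure_avoid_eq_one_of_nonpos hα (h𝓕 A hA))
  -- which is impossible for a (nonempty) configuration
  have hfalse : ∀ᵐ K ∂P, False := hae.mono fun K hK ↦ by
    obtain ⟨k, hk⟩ := K.isConnected.nonempty
    obtain ⟨A, hA, hkA⟩ := hcover (K.subset_upperHalfPlaneSet hk)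
    exact Set.disjoint_left.1 (RestrictionConfig.mem_avoid.1 (hK A hA)) hk hkA
  exact IsProbabilityMeasure.ne_zero P (ae_eq_bot.1 (eventually_false_iff_eq_bot.1 hfalse))

/-! ### The two deep ingredients of p. 5 result 2, as named facts -/

/-- NAMED FACT — **[LSW] Corollary 8.6** (p. 37), verbatim: "For all `α < 5/8`, the two-sided
restriction probability measure `P_α` does not exist." Here `P_α` is any `P` with
`IsRestrictionMeasure α P` (Prop. 3.3 (3) / Def. 3.4, where `α > 0` is standing; the case
`α ≤ 0` is `IsRestrictionMeasure.exponent_pos`, proved). Proof in the paper: if `K` has law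
`P_α`, `α < 5/8`, then `Fill(K)` has the law `P⁺_α` of the one-sided restriction measure, which
is that of an SLE(8/3, ρ) hull with `ρ = ρ(α) < 0` (Thm. 8.4, Cor. 8.5), passing to the right of
`i` with probability `> 1/2`; but by the symmetry of `P_α` (uniqueness, Prop. 3.3) this
probability is `≤ 1/2`. (Remark 3.7 gives the weaker bound `α ≥ 1/2` by an elementary
symmetry argument with the quarter circle, `Φ'_A(0) = 1/4`.) NOT a new obligation: this is
literally the "only if" half of the tree's named fact `exists_isRestrictionMeasure_iff` (p. 5
result 1), see `not_exists_isRestrictionMeasure_of_lt_five_eighths_of_iff`; it is named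
separately only as the leaf used by the assembly below.
[cite: LawlerSchrammWerner2003Restriction, Cor. 8.6 (p. 37)] -/
def not_exists_isRestrictionMeasure_of_lt_five_eighths : Prop :=
  ∀ {α : ℝ}, 0 < α → α < 5 / 8 → ¬ ∃ P : Measure RestrictionConfig, IsRestrictionMeasure α P

/-- Cor. 8.6 is the "only if" half of p. 5 result 1 (`exists_isRestrictionMeasure_iff`). [cite: LawlerSchrammWerner2003Restriction, p. 5 result 1 and Cor. 8.6 (p. 37)] -/
theorem not_exists_isRestrictionMeasure_of_lt_five_eighths_of_iff
    (h : exists_isRestrictionMeasure_iff) : not_exists_isRestrictionMeasure_of_lt_five_eighths :=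
  fun hα hlt hex ↦ absurd ((h _ hα).1 hex) (not_le.2 hlt)

/-- **`5/8 ≤ α` for every restriction measure `P_α`**, from Cor. 8.6 (hypothesis `h86`) and the
proved positivity of the exponent. [cite: LawlerSchrammWerner2003Restriction, Cor. 8.6 (p. 37) with Prop. 3.3] -/
theorem IsRestrictionMeasure.five_eighths_le (h86 : not_exists_isRestrictionMeasure_of_lt_five_eighths)
    {α : ℝ} {P : Measure RestrictionConfig} (h : IsRestrictionMeasure α P) : 5 / 8 ≤ α :=
  not_lt.1 fun hlt ↦ h86 h.exponent_pos hlt ⟨P, h⟩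

/-- NAMED FACT — **the interior-point form of [LSW] Thm. 7.3 (p. 29): for `α > 5/8`,
`P_α`-almost every configuration has an interior point.** Printed ingredients: Thm. 7.3, "For
any `κ ∈ [0, 8/3]`, the law of `Ξ(κ)` is `P_{α_κ}`", where (§7.2)
`Ξ(κ) = Fill(γ(0, ∞) ∪ ⋃ X̂)`, `γ` the SLE_κ path, `X̂ = {g_t⁻¹(K + W_t) : (K, t) ∈ X}` and `X`
a Poisson point process of intensity `λ μ × dt` on `Ω_b × [0, ∞)`, with
`α_κ = (6 − κ)/(2κ)`, `λ_κ = (8 − 3κ)(6 − κ)/(2κ)` — so that every `α > 5/8` is `α_κ` for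
`κ = 6/(2α + 1) ∈ (0, 8/3)`, where `λ_κ > 0` ("for all `α > 5/8`, the measure `P_α` exists
and can be constructed by adding bubbles with appropriate intensity to SLE_κ", p. 29); §7.1:
the bubble measure `μ` is the image under `z ↦ −1/z` of `ν`, "a σ-finite but infinite
measure", a bubble being the filling `Fill(Z[0, ∞))` of a Brownian excursion; and the
uniqueness of `P_α` (Prop. 3.3, last sentence), by which EVERY `P` with
`IsRestrictionMeasure α P`, `α > 5/8`, is the law of `Ξ(κ)`. Standard inputs not spelled out
in [LSW]: a Poisson process with infinite intensity measure has (infinitely many) points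
almost surely, the filling of a planar Brownian loop has interior points almost surely (the
loop disconnects discs from `∞`), and the conformal maps `z ↦ g_t⁻¹(z + W_t)` are open, so
`Ξ(κ) ⊇ g_t⁻¹(K + W_t)` has interior points. The event `{K : int K ≠ ∅}` is measurable for
the avoidance σ-field (`RestrictionConfig.measurableSet_interior_nonempty`, proved), so the
almost-everywhere form below is the statement "`P_α{int K ≠ ∅} = 1`". Not in the tree: SLE_κ
as a random simple curve for `κ < 8/3` ([42]), `μ`, Poisson clouds of hulls, Thm. 7.3.
[cite: LawlerSchrammWerner2003Restriction, Thm. 7.3 (p. 29) with §7.1–7.2 and Prop. 3.3] -/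
def IsRestrictionMeasure.ae_interior_nonempty_of_gt_five_eighths : Prop :=
  ∀ {α : ℝ} {P : Measure RestrictionConfig}, IsRestrictionMeasure α P → 5 / 8 < α →
    ∀ᵐ K : RestrictionConfig ∂P, (interior (K : Set ℂ)).Nonempty

/-- **`P_α`, `α > 5/8`, is not supported on simple curves** ([LSW] p. 5 result 2 for
`α > 5/8`, outer reading), PROVED from the interior-point form of Thm. 7.3 (hypothesis `h73`):
the measurable event `{int K = ∅}` contains every simple-curve configuration
(`RestrictionConfig.IsSimplePath.interior_eq_empty`) and is `P_α`-null, so some measurable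
event containing the simple curves has `P_α`-probability `< 1`
(`RestrictionConfig.exists_measurableSet_simple_subset_of_ae_interior_nonempty`).
[cite: LawlerSchrammWerner2003Restriction, p. 5 results 2–3 with Thm. 7.3 (p. 29)] -/
theorem IsRestrictionMeasure.exists_measure_lt_one_of_gt_five_eighths
    (h73 : IsRestrictionMeasure.ae_interior_nonempty_of_gt_five_eighths)
    {α : ℝ} {P : Measure RestrictionConfig} (hP : IsRestrictionMeasure α P) (hα : 5 / 8 < α) :
    ∃ S : Set RestrictionConfig, MeasurableSet S ∧ {K | K.IsSimplePath} ⊆ S ∧ P S < 1 :=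
  RestrictionConfig.exists_measurableSet_simple_subset_of_ae_interior_nonempty P (h73 hP hα)

/-! ### Assembly -/

/-- **[LSW] p. 5 result 2, first sentence (outer reading), from its two deep ingredients**:
Cor. 8.6 (`h86`, no `P_α` for `0 < α < 5/8`) and the interior-point form of Thm. 7.3 (`h73`),
together with the PROVED positivity of the exponent, measurability of `{int K ≠ ∅}` and
emptiness of the interior of simple curves: a restriction measure `P_α` for which every
measurable event containing the simple curves is almost sure has `α = 5/8`.
[cite: LawlerSchrammWerner2003Restriction, p. 5 result 2; Thm. 7.3 (p. 29), Cor. 8.6 (p. 37)] -/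
theorem IsRestrictionMeasure.eq_five_eighths_of_outer_simple_of_facts
    (h86 : not_exists_isRestrictionMeasure_of_lt_five_eighths)
    (h73 : IsRestrictionMeasure.ae_interior_nonempty_of_gt_five_eighths) :
    IsRestrictionMeasure.eq_five_eighths_of_outer_simple := by
  intro α P hP hsupp
  rcases (IsRestrictionMeasure.five_eighths_le h86 hP).eq_or_lt with heq | hgt
  · exact heq.symm
  · obtain ⟨S, hS, hsub, hlt⟩ := IsRestrictionMeasure.exists_measure_lt_one_of_gt_five_eighths h73 hP hgt
    exact absurd (hsupp S hS hsub) hlt.ne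

/-- The same assembly with Cor. 8.6 supplied by the tree's named fact
`exists_isRestrictionMeasure_iff` (p. 5 result 1), of which it is the "only if" half.
[cite: LawlerSchrammWerner2003Restriction, p. 5 results 1–2; Thm. 7.3 (p. 29), Cor. 8.6 (p. 37)] -/
theorem IsRestrictionMeasure.eq_five_eighths_of_outer_simple_of_iff
    (h1 : exists_isRestrictionMeasure_iff)
    (h73 : IsRestrictionMeasure.ae_interior_nonempty_of_gt_five_eighths) :
    IsRestrictionMeasure.eq_five_eighths_of_outer_simple :=
  IsRestrictionMeasure.eq_five_eighths_of_outer_simple_of_facts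
    (not_exists_isRestrictionMeasure_of_lt_five_eighths_of_iff h1) h73

end Literature.Probability.RandomPlanarGeometry

end
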